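import Summits.QuantumFields.YangMills.Theorems.SwapVirialDeficitBlowUpGnomonicSeamFloorCoords
import Summits.QuantumFields.YangMills.Theorems.SwapVirialDeficitBlowUpGnomonicSeamCommutatorFloorTwo
import HarnessLib

/-!
# THE `[C₁, C₂]` SEAM FLOOR IN COORDINATES: `|y₀·(R(ψ)u + ζ(z)) − x₀·v|² / (225·L⁶·(1+x₀²)(1+y₀²)) ≤ Q(w)`
# (free-hands support of ⟨stmt-QuantumFields-24197⟩ `SwapVirialDeficit.SwapGluedStiffness`; stub S3∕S4 «finiteness of the bottom measure» — sequel of ✓`…SeamFloorCoords`)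

✓`fibre_raySecond_ge_seamComm₂` bounds the fibre Hessian by `‖W′·ŷ₀ + x̂₀·Y′ − Y′·x̂₀ − ŷ₀·W′‖²/(900L⁶)`; reading the quaternions in coordinates (`A₀ = re a/‖a‖`,
`A₁ = ‖im a‖/‖a‖`, rotation `R = [[A₀²−A₁², 2A₀A₁],[−2A₀A₁, A₀²−A₁²]]`, `ζ(z) = (z₁ − x₀z₂, z₂ + x₀z₁)`):
* ★★★ `fibre_raySecond_ge_seamComm₂_coords`:
  `[(y₀((A₀²−A₁²)u₀ + 2A₀A₁u₁ + (z₁ − x₀z₂)) − x₀v₀)² + (y₀(−2A₀A₁u₀ + (A₀²−A₁²)u₁ + (z₂ + x₀z₁)) − x₀v₁)²] / (225·L⁶·(1+x₀²)(1+y₀²)) ≤ (d²/ds²)F̂(η₀ + s·ξ(w))|₀`.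
At the tip (`R = 1`) this is the relative rotation `|y₀u − x₀v|²` of ✓`gnoDeficit_one_ge_relRot` again; at the END (`ψ = π/2`, `R = −1`) it is `|y₀u + x₀v|²`, so the
two together make `y₀²|u|²` and `x₀²|v|²` stiff at the end — with ✓`fibre_raySecond_ge_seamComm_coords` (`4A₁²x₀²|u|²`) and ✓`fibre_raySecond_ge_aniso` this completes
the explicit soft block of the sector-000 bottom (determinant per transverse component `ab + eb + (a+e)(c+c′)x₀² + b(c+c′)y₀² + 4cc′x₀²y₀²sin²ψ`).

HONEST LABEL: quaternion component algebra on a landed floor; S3∕S4∕S5, ⟨24197⟩ ∕ ⟨24194⟩ ∕ ⟨24497⟩ OPEN; own crux ⟨22884⟩ OPEN (blocked-on ⟨19935⟩); the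
Yang–Mills mass gap is NOT proved; no summit is proved by a line.  THEOREMS ONLY (0 `def`, 0 `sorry`), standard axioms.
Width seat ym-line-sfw-p2-w3 g66 (cell ym-idea-1, free hands), `--supports stmt-QuantumFields-24197`.  References: [cite: Luscher1983, §2]; [folklore].
-/

set_option autoImplicit false

noncomputable section

open MeasureTheory Quaternion
open scoped BigOperators Quaternion
open Literature.MathematicalPhysics.QuantumFieldTheory hiding SU2
open Literature.MathematicalPhysics.QuantumLattice
open Literature.Analysis.Calculus (radialUnit radialUnit_def norm_radialUnit)

namespace Summit.QuantumFields.YangMills.Theorems.SwapVirialDeficit.BlowUpRing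

open Summit.QuantumFields.YangMills.Theorems.FemtoTransferGap
open Summit.QuantumFields.YangMills.Theorems.SwapTwistDeficit.ToronLog (axisPoint)
open Summit.QuantumFields.YangMills.Theorems.SwapVirialDeficit.ZeroModeSigma (norm_axisUnit axisUnit_axial axial_sq_add_sq)

variable {L : ℕ} [NeZero L]

/-- ★★★ **THE `[C₁,C₂]` FLOOR IN COORDINATES** (principal sector, `ε_z = +`, followers `+`, hub `a ≠ 0`; `A₀ = re a/‖a‖`, `A₁ = ‖im a‖/‖a‖`):
`[(y₀((A₀²−A₁²)u₀ + 2A₀A₁u₁ + (z₁ − x₀z₂)) − x₀v₀)² + (y₀(−2A₀A₁u₀ + (A₀²−A₁²)u₁ + (z₂ + x₀z₁)) − x₀v₁)²] / (225·L⁶·(1+x₀²)(1+y₀²)) ≤ (d²/ds²)F̂(η₀ + s·ξ(w))|₀`.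
[cite: Luscher1983, §2] -/
theorem fibre_raySecond_ge_seamComm₂_coords {a : ℍ} (ha : a ≠ 0) (ε : GnoSign L) (hz : ε.2.1 = true) (hε : ε.2.2 = fun _ => true) (x₀ y₀ : ℝ)
    (w : ((Fin 2 → ℝ) × (Fin 2 → ℝ)) × (Fin 3 → ℝ) × (Fol L → Fin 3 → ℝ)) :
    ((y₀ * (((‖a‖⁻¹ * a.re) ^ 2 - (‖a‖⁻¹ * ‖a.im‖) ^ 2) * w.1.1 0 + 2 * (‖a‖⁻¹ * a.re) * (‖a‖⁻¹ * ‖a.im‖) * w.1.1 1 + (w.2.1 1 - x₀ * w.2.1 2)) - x₀ * w.1.2 0) ^ 2 +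
        (y₀ * (-(2 * (‖a‖⁻¹ * a.re) * (‖a‖⁻¹ * ‖a.im‖)) * w.1.1 0 + ((‖a‖⁻¹ * a.re) ^ 2 - (‖a‖⁻¹ * ‖a.im‖) ^ 2) * w.1.1 1 + (w.2.1 2 + x₀ * w.2.1 1)) - x₀ * w.1.2 1) ^ 2) /
        (225 * (L : ℝ) ^ 6 * ((1 + x₀ ^ 2) * (1 + y₀ ^ 2))) ≤
      iteratedDeriv 2 (fun s : ℝ => gnoDeficit (fun _ => false) (fun _ => 1) a ε
        (((((![x₀, 0, 0] : Fin 3 → ℝ), (![y₀, 0, 0] : Fin 3 → ℝ)), ((0 : Fin 3 → ℝ), (0 : Fol L → Fin 3 → ℝ))) : GnoCoord L) +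
          s • ((((![0, w.1.1 0, w.1.1 1] : Fin 3 → ℝ), (![0, w.1.2 0, w.1.2 1] : Fin 3 → ℝ)), (w.2.1, w.2.2)) : GnoCoord L))) 0 := by
  have hL : (0 : ℝ) < L := by exact_mod_cast NeZero.pos L
  have h := fibre_raySecond_ge_seamComm₂ (L := L) ha ε hz hε x₀ y₀ w
  refine le_trans (le_of_eq ?_) h
  -- names and components
  set A : ℍ := radialUnit (axisPoint a) with hA
  set N : ℝ := Real.sqrt (1 + x₀ ^ 2) with hN
  set M : ℝ := Real.sqrt (1 + y₀ ^ 2) with hM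
  set σ : ℝ := gnoSign ε.1.1 with hσ
  set τ : ℝ := gnoSign ε.1.2 with hτ
  set X' : ℍ := N⁻¹ • (σ • (gnomonicQuat ![0, w.1.1 0, w.1.1 1]).im) with hX'
  set Y' : ℍ := M⁻¹ • (τ • (gnomonicQuat ![0, w.1.2 0, w.1.2 1]).im) with hY'
  set Z' : ℍ := (gnomonicQuat w.2.1).im with hZ'
  set xh : ℍ := radialUnit (gnoLetter ε.1.1 ![x₀, 0, 0]) with hxh
  set yh : ℍ := radialUnit (gnoLetter ε.1.2 ![y₀, 0, 0]) with hyh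
  set W' : ℍ := star A * X' * A + xh * Z' with hW'
  set g : ℍ := W' * yh + xh * Y' - Y' * xh - yh * W' with hg
  obtain ⟨hAre, hAimI, hAimJ, hAimK⟩ := axisUnit_components a
  obtain ⟨hxre, hximI, hximJ, hximK⟩ := radialUnit_gnoLetter_axial_components ε.1.1 x₀
  obtain ⟨hyre, hyimI, hyimJ, hyimK⟩ := radialUnit_gnoLetter_axial_components ε.1.2 y₀
  obtain ⟨hPre, hPimI, hPimJ, hPimK⟩ := gnomonicQuat_im_components (![0, w.1.1 0, w.1.1 1] : Fin 3 → ℝ)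
  obtain ⟨hVre, hVimI, hVimJ, hVimK⟩ := gnomonicQuat_im_components (![0, w.1.2 0, w.1.2 1] : Fin 3 → ℝ)
  obtain ⟨hZre, hZimI, hZimJ, hZimK⟩ := gnomonicQuat_im_components (w.2.1)
  rw [← hA] at hAre hAimI hAimJ hAimK
  rw [← hxh] at hxre hximI hximJ hximK
  rw [← hyh] at hyre hyimI hyimJ hyimK
  rw [← hZ'] at hZre hZimI hZimJ hZimK
  have hX're : X'.re = 0 := by rw [hX', Quaternion.re_smul, Quaternion.re_smul, hPre]; simp
  have hX'imI : X'.imI = 0 := by rw [hX', Quaternion.imI_smul, Quaternion.imI_smul, hPimI]; simp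
  have hX'imJ : X'.imJ = N⁻¹ * (σ * w.1.1 0) := by
    rw [hX', Quaternion.imJ_smul, Quaternion.imJ_smul, hPimJ]; simp [smul_eq_mul]
  have hX'imK : X'.imK = N⁻¹ * (σ * w.1.1 1) := by
    rw [hX', Quaternion.imK_smul, Quaternion.imK_smul, hPimK]; simp [smul_eq_mul]
  have hY're : Y'.re = 0 := by rw [hY', Quaternion.re_smul, Quaternion.re_smul, hVre]; simp
  have hY'imI : Y'.imI = 0 := by rw [hY', Quaternion.imI_smul, Quaternion.imI_smul, hVimI]; simp
  have hY'imJ : Y'.imJ = M⁻¹ * (τ * w.1.2 0) := by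
    rw [hY', Quaternion.imJ_smul, Quaternion.imJ_smul, hVimJ]; simp [smul_eq_mul]
  have hY'imK : Y'.imK = M⁻¹ * (τ * w.1.2 1) := by
    rw [hY', Quaternion.imK_smul, Quaternion.imK_smul, hVimK]; simp [smul_eq_mul]
  obtain ⟨hCre, hCimI, hCimJ, hCimK⟩ := conj_axial_transverse_components (A := A) (P := X') ⟨hAimJ, hAimK⟩ ⟨hX're, hX'imI⟩
  -- components of `W'` in closed form
  have hWre : W'.re = -(N⁻¹ * σ * x₀ * w.2.1 0) := by
    rw [hW', Quaternion.re_add, hCre, Quaternion.re_mul, hxre, hximI, hximJ, hximK, hZre, hZimI, hZimJ, hZimK]; ring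
  have hWimI : W'.imI = N⁻¹ * σ * w.2.1 0 := by
    rw [hW', Quaternion.imI_add, hCimI, Quaternion.imI_mul, hxre, hximI, hximJ, hximK, hZre, hZimI, hZimJ, hZimK]; ring
  have hWimJ : W'.imJ = N⁻¹ * σ * (((‖a‖⁻¹ * a.re) ^ 2 - (‖a‖⁻¹ * ‖a.im‖) ^ 2) * w.1.1 0 + 2 * (‖a‖⁻¹ * a.re) * (‖a‖⁻¹ * ‖a.im‖) * w.1.1 1 +
      (w.2.1 1 - x₀ * w.2.1 2)) := by
    rw [hW', Quaternion.imJ_add, hCimJ, Quaternion.imJ_mul, hAre, hAimI, hX'imJ, hX'imK, hxre, hximI, hximJ, hximK, hZre, hZimI, hZimJ, hZimK]; ring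
  have hWimK : W'.imK = N⁻¹ * σ * (-(2 * (‖a‖⁻¹ * a.re) * (‖a‖⁻¹ * ‖a.im‖)) * w.1.1 0 + ((‖a‖⁻¹ * a.re) ^ 2 - (‖a‖⁻¹ * ‖a.im‖) ^ 2) * w.1.1 1 +
      (w.2.1 2 + x₀ * w.2.1 1)) := by
    rw [hW', Quaternion.imK_add, hCimK, Quaternion.imK_mul, hAre, hAimI, hX'imJ, hX'imK, hxre, hximI, hximJ, hximK, hZre, hZimI, hZimJ, hZimK]; ring
  -- components of `g`
  have hgre : g.re = 0 := by
    simp only [hg, Quaternion.re_sub, Quaternion.re_add, Quaternion.re_mul, hWre, hWimI, hWimJ, hWimK, hxre, hximI, hximJ, hximK, hyre, hyimI,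
      hyimJ, hyimK, hY're, hY'imI, hY'imJ, hY'imK]
    ring
  have hgimI : g.imI = 0 := by
    simp only [hg, Quaternion.imI_sub, Quaternion.imI_add, Quaternion.imI_mul, hWre, hWimI, hWimJ, hWimK, hxre, hximI, hximJ, hximK, hyre, hyimI,
      hyimJ, hyimK, hY're, hY'imI, hY'imJ, hY'imK]
    ring
  have hgimJ : g.imJ = 2 * (N⁻¹ * M⁻¹) * (σ * τ) *
      (y₀ * (-(2 * (‖a‖⁻¹ * a.re) * (‖a‖⁻¹ * ‖a.im‖)) * w.1.1 0 + ((‖a‖⁻¹ * a.re) ^ 2 - (‖a‖⁻¹ * ‖a.im‖) ^ 2) * w.1.1 1 + (w.2.1 2 + x₀ * w.2.1 1)) -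
        x₀ * w.1.2 1) := by
    simp only [hg, Quaternion.imJ_sub, Quaternion.imJ_add, Quaternion.imJ_mul, hWre, hWimI, hWimJ, hWimK, hxre, hximI, hximJ, hximK, hyre, hyimI,
      hyimJ, hyimK, hY're, hY'imI, hY'imJ, hY'imK]
    ring
  have hgimK : g.imK = -(2 * (N⁻¹ * M⁻¹) * (σ * τ) *
      (y₀ * (((‖a‖⁻¹ * a.re) ^ 2 - (‖a‖⁻¹ * ‖a.im‖) ^ 2) * w.1.1 0 + 2 * (‖a‖⁻¹ * a.re) * (‖a‖⁻¹ * ‖a.im‖) * w.1.1 1 + (w.2.1 1 - x₀ * w.2.1 2)) -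
        x₀ * w.1.2 0)) := by
    simp only [hg, Quaternion.imK_sub, Quaternion.imK_add, Quaternion.imK_mul, hWre, hWimI, hWimJ, hWimK, hxre, hximI, hximJ, hximK, hyre, hyimI,
      hyimJ, hyimK, hY're, hY'imI, hY'imJ, hY'imK]
    ring
  -- the norm of `g` through its four components
  have hnorm : ‖g‖ ^ 2 = g.re ^ 2 + g.imI ^ 2 + g.imJ ^ 2 + g.imK ^ 2 := by
    rw [sq, ← Quaternion.normSq_eq_norm_mul_self, Quaternion.normSq_def']
  rw [hnorm, hgre, hgimI, hgimJ, hgimK]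
  -- scalar facts and the final identity
  have hσ2 : σ ^ 2 = 1 := gnoSign_sq ε.1.1
  have hτ2 : τ ^ 2 = 1 := gnoSign_sq ε.1.2
  have hx1 : (0 : ℝ) < 1 + x₀ ^ 2 := by positivity
  have hy1 : (0 : ℝ) < 1 + y₀ ^ 2 := by positivity
  have ht2 : (N⁻¹) ^ 2 = (1 + x₀ ^ 2)⁻¹ := by rw [inv_pow, hN, Real.sq_sqrt hx1.le]
  have ht'2 : (M⁻¹) ^ 2 = (1 + y₀ ^ 2)⁻¹ := by rw [inv_pow, hM, Real.sq_sqrt hy1.le]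
  set P : ℝ := y₀ * (-(2 * (‖a‖⁻¹ * a.re) * (‖a‖⁻¹ * ‖a.im‖)) * w.1.1 0 + ((‖a‖⁻¹ * a.re) ^ 2 - (‖a‖⁻¹ * ‖a.im‖) ^ 2) * w.1.1 1 + (w.2.1 2 + x₀ * w.2.1 1)) -
    x₀ * w.1.2 1 with hP
  set Q : ℝ := y₀ * (((‖a‖⁻¹ * a.re) ^ 2 - (‖a‖⁻¹ * ‖a.im‖) ^ 2) * w.1.1 0 + 2 * (‖a‖⁻¹ * a.re) * (‖a‖⁻¹ * ‖a.im‖) * w.1.1 1 + (w.2.1 1 - x₀ * w.2.1 2)) -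
    x₀ * w.1.2 0 with hQ
  have e4 : (0 : ℝ) ^ 2 + 0 ^ 2 + (2 * (N⁻¹ * M⁻¹) * (σ * τ) * P) ^ 2 + (-(2 * (N⁻¹ * M⁻¹) * (σ * τ) * Q)) ^ 2 =
      4 * ((N⁻¹) ^ 2 * (M⁻¹) ^ 2) * (σ ^ 2 * τ ^ 2) * (Q ^ 2 + P ^ 2) := by ring
  rw [e4, hσ2, hτ2, ht2, ht'2]
  field_simp
  ring

end Summit.QuantumFields.YangMills.Theorems.SwapVirialDeficit.BlowUpRing

end
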